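import Summits.HodgeConjecture.HodgeCM.PerL34.GenuineSchrodingerSchwartzExtend_1

/-! PORT of `HodgeCM/PerL34/GenuineSchrodingerSchwartzExtend.lean` (HodgeCMPerL run 82) — part 2: continuation of `Summits.HodgeConjecture.HodgeCM.PerL34.GenuineSchrodingerSchwartzExtend_1` (split at a top-level declaration boundary by port_pkg.py; scope re-opened below; declarations unchanged). -/

-- port_pkg: scope re-opened for this part (file-level context, then the namespace/section stack open at the cut)
set_option autoImplicit false
noncomputable section
open MeasureTheory MeasureTheory.Measure Set Metric Function Complex Topology Filter
open scoped RestrictedProduct InnerProductSpace NNReal ENNReal Pointwise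
namespace HodgeCM.PerL34.PureTensor.SchrodingerModel
open HodgeCM.PerL34.LocalFactors HodgeCM.PerL34.LocalFactors.DilationModel
open HodgeCM.PerL34.LocalFactors.SchrodingerLevi
open HodgeCM.PerL34.IdelePlaces HodgeCM.PerL34.IdelicTorusModel HodgeCM.PerL34.IdelicTorusModel.Genuine
open NumberField IsDedekindDomain
attribute [local instance] LocalFactors.DilationModel.Adic.nontriviallyNormedField
  LocalFactors.DilationModel.Adic.properSpace
variable {L : Type} [Field L] [NumberField L] [IsCMField L]
namespace Coeff
section End
variable (ψ : ∀ i : SplitIdx L, AddChar ((basePlaceOf L i.1).adicCompletion (maximalRealSubfield L)) Circle)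
  (hψc : ∀ i, Continuous (ψ i))
  (hψO : ∀ᶠ i : SplitIdx L in cofinite,
    ∀ t : (basePlaceOf L i.1).adicCompletion (maximalRealSubfield L), ‖t‖ ≤ 1 → ψ i t = 1)
variable {ψ} in
/-- **END (a). A representation of `K_split` on `𝒮(X)` by `L²`-isometric automorphisms satisfying
the Heisenberg relations on `𝒮(X)` extends to `rep L ν` for a unique `ν`.** -/
theorem extendRep_eq_rep_of_heisenberg [DecidableEq (Place (maximalRealSubfield L))]
    (hψ : ∀ i, ∃ t, ψ i t ≠ 1) (π : Model L →* Module.End ℂ (schwartzBruhat L))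
    (hπ : ∀ (k : Model L) (f : schwartzBruhat L), ‖π k f‖ = ‖f‖)
    (hτ : ∀ (k : Model L) (y : Space L) (f : schwartzBruhat L),
      π k (translateS y f) = translateS (k⁻¹ • y) (π k f))
    (hM : ∀ (k : Model L) (ξ : Space L) (f : schwartzBruhat L),
      π k (heisModS ψ hψc hψO ξ f) = heisModS ψ hψc hψO (k • ξ) (π k f)) :
    ∃! ν : Model L →* Circle, extendRep π hπ = rep L ν :=
  rep_unique_of_heisenberg ψ hψc hψO hψ (extendRep π hπ)
    (extendRep_translate π hπ (fun k y => k⁻¹ • y) hτ)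
    (fun k ξ f => extendRep_modulate π hπ k _ _ _ _ (hM k ξ) f)

variable {ψ} in
/-- **END (b), on `𝒮(X)` itself.** Under the same hypotheses `π` IS `k ↦ rep L ν k|_{𝒮(X)}` for a
unique character `ν : K_split →* S¹`: the genuine operators `ν(k) |k|^{1/2} f(k⁻¹ x)` are forced by
the Heisenberg relations already at the level of Schwartz–Bruhat functions. -/
theorem exists_unique_eq_repS_of_heisenberg [DecidableEq (Place (maximalRealSubfield L))]
    (hψ : ∀ i, ∃ t, ψ i t ≠ 1) (π : Model L →* Module.End ℂ (schwartzBruhat L))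
    (hπ : ∀ (k : Model L) (f : schwartzBruhat L), ‖π k f‖ = ‖f‖)
    (hτ : ∀ (k : Model L) (y : Space L) (f : schwartzBruhat L),
      π k (translateS y f) = translateS (k⁻¹ • y) (π k f))
    (hM : ∀ (k : Model L) (ξ : Space L) (f : schwartzBruhat L),
      π k (heisModS ψ hψc hψO ξ f) = heisModS ψ hψc hψO (k • ξ) (π k f)) :
    ∃! ν : Model L →* Circle, ∀ k, π k = repS ν k := by
  obtain ⟨ν, hν, hu⟩ := extendRep_eq_rep_of_heisenberg hψc hψO hψ π hπ hτ hM
  refine ⟨ν, fun k => LinearMap.ext fun f => Subtype.ext ?_, fun ν' hν' => hu ν' ?_⟩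
  · rw [coe_repS_apply, ← hν, extendRep_apply_coe]
  · refine (extendRep_unique π hπ (rep L ν') fun k f => ?_).symm
    rw [hν' k, coe_repS_apply]

/-- and the characterisation: `π` is a restricted `rep L ν` iff it is norm-preserving and satisfies
the two Heisenberg relations on `𝒮(X)` -/
theorem exists_eq_repS_iff_heisenberg [DecidableEq (Place (maximalRealSubfield L))]
    (hψ : ∀ i, ∃ t, ψ i t ≠ 1) (π : Model L →* Module.End ℂ (schwartzBruhat L)) :
    (∃ ν : Model L →* Circle, ∀ k, π k = repS ν k) ↔
      (∀ (k : Model L) (f : schwartzBruhat L), ‖π k f‖ = ‖f‖) ∧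
      (∀ (k : Model L) (y : Space L) (f : schwartzBruhat L),
          π k (translateS y f) = translateS (k⁻¹ • y) (π k f)) ∧
        ∀ (k : Model L) (ξ : Space L) (f : schwartzBruhat L),
          π k (heisModS ψ hψc hψO ξ f) = heisModS ψ hψc hψO (k • ξ) (π k f) := by
  constructor
  · rintro ⟨ν, hν⟩
    refine ⟨fun k f => ?_, fun k y f => ?_, fun k ξ f => ?_⟩
    · rw [hν k]; exact norm_repS_apply ν k f
    · rw [hν k]; exact repS_translateS ν k y f
    · rw [hν k]; exact repS_heisModS ψ hψc hψO ν k ξ f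
  · rintro ⟨hπ, hτ, hM⟩
    exact (exists_unique_eq_repS_of_heisenberg hψc hψO hψ π hπ hτ hM).exists

end End

end Coeff

end HodgeCM.PerL34.PureTensor.SchrodingerModel

-- port_pkg: scope closed for this part
end
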